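/- Free-seat work of WIDTH SEAT `ym-line-cbag-p1-w2` (prover-ym-line-cbag-p1-w2-g18-0), route `EguchiKawaiDirectionLadder`
(ideator ym-idea-2, LINE 8), crux `TripleSmallBallMargin` (stmt-QuantumFields-27724), v7 last mile: the PAIR-COUNT identities that
feed the hypotheses `hXB : X ≤ B` and `hwithin : Σ_c C(n_c,2) + B = C(N,2)` of the margin bookkeeping (LEAD spec
`MarginBookkeepingSpec.lean`, width seat w3) for a total labelling `ℓ : Fin N → Fin (m+1)` (collar = `Fin.last m`), in the pair
vocabulary of width seat w5's `PairPartition`, plus the reindexing of products over `labelledBlocks m` by `Fin m`.  Finite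
combinatorics only, ROUTE-INDEPENDENT.  The route bears on the barrier-ledger fact `EguchiKawaiBreakdown`; the Yang–Mills mass gap
is NOT proved by anything here. -/
import Summits.QuantumFields.YangMills.Theorems.EguchiKawaiDirectionLadderPairPartition
import Summits.QuantumFields.YangMills.Theorems.EguchiKawaiDirectionLadderSymFibreDecoupled
import Summits.QuantumFields.YangMills.Theorems.EguchiKawaiDirectionLadderSpectralWindowLaw
import HarnessLib

/-!
# Route `EguchiKawaiDirectionLadder`, crux `TripleSmallBallMargin`: pair counts of a block labelling

For `ℓ : Fin N → Fin (m+1)` write `n_c = #{ℓ = castSucc c}`, `within p :⇔ ℓ p.1 = ℓ p.2 ≠ last`,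
`B(ℓ) = #{p : p.1 < p.2, ¬ within p}`, `X'(ℓ) = #{p : p.1 < p.2, ℓ p.1 ≠ ℓ p.2, ℓ p.1 ≠ last, ℓ p.2 ≠ last}`.

* `card_ltPairs_eq_choose` — `#{p : p.1 < p.2} = C(N,2)`;
* `card_pairs_mem_eq_choose` — `#{p : p.1 < p.2, p.1 ∈ S, p.2 ∈ S} = C(#S, 2)`;
* `card_within_eq_sum_choose` — `#{p : p.1 < p.2, within p} = Σ_c C(n_c, 2)`;
* `sum_choose_blocks_add_card_notWithin` — `Σ_c C(n_c,2) + B(ℓ) = C(N,2)` (the `hwithin` hypothesis);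
* `card_crossPairs_le_card_notWithin` — `X'(ℓ) ≤ B(ℓ)` (the `hXB` hypothesis);
* `prod_labelledBlocks_eq_prod_castSucc` — `∏_{c ∈ labelledBlocks m} g c = ∏_{c : Fin m} g (castSucc c)`.
-/

set_option autoImplicit false

open Finset

namespace Summit.QuantumFields.YangMills.Theorems.EguchiKawaiDirectionLadder

namespace PairCounts

variable {N m : ℕ}

/-- `(2:ℝ)^a = (2:ℝ)^b ⇒ a = b` (exponent read-off used to turn product identities into count identities). -/
theorem nat_eq_of_two_pow_eq {a b : ℕ} (h : (2 : ℝ) ^ a = (2 : ℝ) ^ b) : a = b := by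
  have h' : (2 : ℕ) ^ a = 2 ^ b := by exact_mod_cast h
  exact Nat.pow_right_injective (le_refl 2) h'

/-- `#{(j,k) : j < k} = C(N,2)`. -/
theorem card_ltPairs_eq_choose :
    ((univ : Finset (Fin N × Fin N)).filter (fun p => p.1 < p.2)).card = N.choose 2 := by
  have h := PairPartition.prod_Ioi_eq_prod_pairs (N := N) (fun _ _ => (2 : ℝ))
  simp only [prod_const] at h
  rw [prod_pow_eq_pow_sum, SpectralWindow.sum_card_Ioi_fin, ← Nat.choose_two_right] at h
  exact (nat_eq_of_two_pow_eq h).symm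

/-- `#{(j,k) : j < k, j ∈ S, k ∈ S} = C(#S, 2)`. -/
theorem card_pairs_mem_eq_choose (S : Finset (Fin N)) :
    ((univ : Finset (Fin N × Fin N)).filter (fun p => p.1 < p.2 ∧ p.1 ∈ S ∧ p.2 ∈ S)).card = S.card.choose 2 := by
  have h := PairPartition.prod_pairs_mem_eq_prod_orderEmbOfFin S rfl (fun _ _ => (2 : ℝ))
  simp only [prod_const] at h
  rw [prod_pow_eq_pow_sum, SpectralWindow.sum_card_Ioi_fin, ← Nat.choose_two_right] at h
  exact nat_eq_of_two_pow_eq h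

/-- `#{(j,k) : j < k, ℓ j = ℓ k = castSucc c} = C(n_c, 2)`. -/
theorem card_blockPairs_eq_choose (ℓ : Fin N → Fin (m + 1)) (c : Fin m) :
    ((univ : Finset (Fin N × Fin N)).filter
        (fun p => p.1 < p.2 ∧ ℓ p.1 = Fin.castSucc c ∧ ℓ p.2 = Fin.castSucc c)).card =
      (univ.filter (fun i => ℓ i = Fin.castSucc c)).card.choose 2 := by
  rw [PairPartition.filter_within_block_eq, card_pairs_mem_eq_choose]

/-- `#{(j,k) : j < k, within} = Σ_c C(n_c, 2)`. -/
theorem card_within_eq_sum_choose (ℓ : Fin N → Fin (m + 1)) :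
    ((univ : Finset (Fin N × Fin N)).filter (fun p => p.1 < p.2 ∧ (ℓ p.1 = ℓ p.2 ∧ ℓ p.1 ≠ Fin.last m))).card =
      ∑ c : Fin m, (univ.filter (fun i => ℓ i = Fin.castSucc c)).card.choose 2 := by
  have h := PairPartition.prod_within_eq_prod_blocks_pairs ℓ (fun _ _ => (2 : ℝ))
  simp only [prod_const] at h
  rw [prod_pow_eq_pow_sum] at h
  rw [nat_eq_of_two_pow_eq h]
  exact sum_congr rfl fun c _ => card_blockPairs_eq_choose ℓ c

/-- **`hwithin`**: `Σ_c C(n_c, 2) + B(ℓ) = C(N, 2)` — the increasing pairs split into within-block pairs and the rest. -/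
theorem sum_choose_blocks_add_card_notWithin (ℓ : Fin N → Fin (m + 1)) :
    ∑ c : Fin m, (univ.filter (fun i => ℓ i = Fin.castSucc c)).card.choose 2 +
        ((univ : Finset (Fin N × Fin N)).filter (fun p => p.1 < p.2 ∧ ¬ (ℓ p.1 = ℓ p.2 ∧ ℓ p.1 ≠ Fin.last m))).card =
      N.choose 2 := by
  have hsplit := card_filter_add_card_filter_not (s := (univ : Finset (Fin N × Fin N)).filter (fun p => p.1 < p.2))
    (fun p => ℓ p.1 = ℓ p.2 ∧ ℓ p.1 ≠ Fin.last m)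
  rw [filter_filter, filter_filter] at hsplit
  rw [← card_within_eq_sum_choose, ← card_ltPairs_eq_choose (N := N)]
  exact hsplit

/-- **`hXB`**: `X'(ℓ) ≤ B(ℓ)` — a labelled cross pair is not a within-block pair. -/
theorem card_crossPairs_le_card_notWithin (ℓ : Fin N → Fin (m + 1)) :
    ((univ : Finset (Fin N × Fin N)).filter
        (fun p => p.1 < p.2 ∧ ℓ p.1 ≠ ℓ p.2 ∧ ℓ p.1 ≠ Fin.last m ∧ ℓ p.2 ≠ Fin.last m)).card ≤
      ((univ : Finset (Fin N × Fin N)).filter (fun p => p.1 < p.2 ∧ ¬ (ℓ p.1 = ℓ p.2 ∧ ℓ p.1 ≠ Fin.last m))).card := by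
  refine card_le_card fun p hp => ?_
  simp only [mem_filter, mem_univ, true_and] at hp ⊢
  exact ⟨hp.1, fun h => hp.2.1 h.1⟩

/-- The same in `ℝ`. -/
theorem card_crossPairs_le_card_notWithin_real (ℓ : Fin N → Fin (m + 1)) :
    (((univ : Finset (Fin N × Fin N)).filter
        (fun p => p.1 < p.2 ∧ ℓ p.1 ≠ ℓ p.2 ∧ ℓ p.1 ≠ Fin.last m ∧ ℓ p.2 ≠ Fin.last m)).card : ℝ) ≤
      (((univ : Finset (Fin N × Fin N)).filter (fun p => p.1 < p.2 ∧ ¬ (ℓ p.1 = ℓ p.2 ∧ ℓ p.1 ≠ Fin.last m))).card : ℝ) := by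
  exact_mod_cast card_crossPairs_le_card_notWithin ℓ

/-- Products over the labelled blocks reindexed by `Fin m`: `∏_{c ∈ labelledBlocks m} g c = ∏_{c : Fin m} g (castSucc c)`. -/
theorem prod_labelledBlocks_eq_prod_castSucc {M : Type*} [CommMonoid M] (g : Fin (m + 1) → M) :
    ∏ c ∈ labelledBlocks m, g c = ∏ c : Fin m, g (Fin.castSucc c) := by
  rw [show labelledBlocks m = univ.filter (fun c => c ≠ Fin.last m) from rfl, prod_filter, Fin.prod_univ_castSucc]
  simp only [ne_eq, not_true_eq_false, if_false, mul_one]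
  refine prod_congr rfl fun c _ => ?_
  rw [if_pos (Fin.castSucc_lt_last c).ne]

end PairCounts

end Summit.QuantumFields.YangMills.Theorems.EguchiKawaiDirectionLadder
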